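import Literature.Geometry.Kaehler.EhresmannChartBallTrivialisation
import Literature.AlgebraicGeometry.HodgeTheory.PeriodIntegralHolomorphicVertical
import Literature.NumberTheory.Transcendental.ComplexFormsPullback
import Literature.Analysis.Complex.OsgoodProofs
import HarnessLib

/-!
# Periods of fibrewise-closed relative forms along a proper holomorphic submersion are holomorphic
# in the base (Griffiths 1968; Voisin I, proof of Thm. 10.9 — the `F^n` case made unconditional)

Family `hodge`, layer `Literature/AlgebraicGeometry/HodgeTheory`. Theorems only; no definition, no named
fact. Written by the prover seat `hodge-nonav-prover-Ax` (g12, cell `hodge-nonav`) as brick F-C (part 2)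
of the programme «GRIFFITHS-SURFACES / B4 RELATIVE RESIDUES» (route `HodgeConjecture/CyclicUnitaryPowers`).

Setting: `π : 𝒳 → B` a proper holomorphic submersion of complex manifolds (`𝒳` Hausdorff, second
countable), fibre models `ι b : X b ≅ π⁻¹(b)` over an open `O ∋ s₀` (all `X b` charted on one `EX`,
`dim EX + dim EB = dim E𝒳`), `X s₀` compact Hausdorff with a continuous orientation family `o`, and a
smooth `(k+1)`-form `Ξ` on `𝒳` such that

* `(ι b)^* Ξ` is CLOSED for every `b ∈ O` (e.g. `Ξ` restricts on every fibre to a holomorphic form of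
  top degree — the relative residue forms of `RelativeResidueForms`), and
* along the fibres over `O`, `dΞ` is `ℂ`-linear in its transverse slot once the other slots are filled
  with VERTICAL vectors (`dπ w = 0`) — the output of the partition-of-unity gluing of local
  holomorphic relative forms.

Conclusion (`IsProperHolomorphicSubmersion.exists_chartBall_trivialisation_periods_analytic`): for the
chart-ball trivialisation `Φ : EB → X s₀ → 𝒳` of `EhresmannChartBallTrivialisation` (all its clauses
are re-exported) and EVERY smooth closed `l`-form `γ` on `X s₀` (`l + (k+1) = dim_ℝ X s₀`), the period
function `p ↦ ∫_{X s₀} γ ∧ (Φ p)^* Ξ` is complex ANALYTIC on the chart ball; and each `(Φ p)^* Ξ` is a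
smooth closed form on `X s₀` (so its de Rham class is defined and, `γ` being closed, the period depends
only on the classes). Proof: at every `p` of the ball the tree's B1
`differentiableAt_complex_cintegral_wedge_pullback_family_of_vertical` applies with the presentation
`Φ p = ι b ∘ e_p` (`b = c⁻¹ p`, `e_p : X s₀ ≅ X b` the diffeomorphism of the trivialisation),
`proj = c ∘ π` (holomorphic, `dproj` `ℂ`-linear), `β = (e_p⁻¹)^* γ` (so `e_p^* β = γ`), verticality by
`exists_mfderiv_eq_of_mfderiv_proj_eq_zero`; complex differentiability on the open ball gives
analyticity by Osgood (`SCV.analyticAt_of_differentiableOn`). This is the holomorphy of the Hodge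
bundle `F^n𝓗^n` (Griffiths 1968 Thm. 1.1 / Voisin I Thm. 10.3 in degree `(n,0)`) in period form, with
NO named fact.

## References

* [Griffiths1968PeriodsII] P. Griffiths, Periods of integrals on algebraic manifolds II, Amer. J. Math.
  90 (1968), Thm. 1.1.
* [VoisinHodgeI2002] C. Voisin, Hodge Theory and Complex Algebraic Geometry I (2002), §9.1.1 Thm. 9.3,
  §9.2.2, §10.2.1 Thm. 10.3, §10.2.2 (proof of Thm. 10.9).
* [Griffiths1969] P. Griffiths, On the periods of certain rational integrals I, Ann. of Math. 90 (1969), §8.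
* [FritzscheGrauert2002] K. Fritzsche, H. Grauert, From Holomorphic Functions to Complex Manifolds
  (2002), Ch. I §8 (Osgood).
-/

noncomputable section

open scoped Manifold ContDiff Topology
open Function Set Filter Metric Complex
open Literature.Geometry.Kaehler Literature.Geometry.Manifold Literature.NumberTheory.Transcendental
open Literature.AlgebraicGeometry.Motives Literature.Analysis.Complex

namespace Literature.AlgebraicGeometry.HodgeTheory

universe u

-- The identification `TangentSpace I x = E` is an abuse of definitional equality; as in the tree's
-- form files we let `isDefEq` unfold it.
set_option backward.isDefEq.respectTransparency false

section Chart

variable {EB : Type u} [NormedAddCommGroup EB] [NormedSpace ℂ EB]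
  {B : Type u} [TopologicalSpace B] [ChartedSpace EB B] [IsManifold 𝓘(ℂ, EB) ω B]

/-- The differential of a (holomorphic, extended) chart is injective at the points of its source
(its inverse is differentiable on the target and `c⁻¹ ∘ c = id` near the point; real structures).
[cite: VoisinHodgeI2002, §2.2.1] -/
theorem injective_mfderiv_real_extChartAt (s₀ : B) {b : B} (hb : b ∈ (extChartAt 𝓘(ℂ, EB) s₀).source) :
    Injective (mfderiv 𝓘(ℝ, EB) 𝓘(ℝ, EB) (extChartAt 𝓘(ℂ, EB) s₀) b) := by
  haveI : IsManifold 𝓘(ℝ, EB) ∞ B := isManifold_real_of_isManifold_complex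
  set c := extChartAt 𝓘(ℝ, EB) s₀ with hc
  have hcℂ : extChartAt 𝓘(ℂ, EB) s₀ = c := rfl
  rw [hcℂ]
  have hbs : b ∈ (chartAt EB s₀).source := by rwa [hcℂ, hc, extChartAt_source] at hb
  have hcd : MDifferentiableAt 𝓘(ℝ, EB) 𝓘(ℝ, EB) c b := mdifferentiableAt_extChartAt hbs
  have hsd : MDifferentiableAt 𝓘(ℝ, EB) 𝓘(ℝ, EB) c.symm (c b) := by
    have h := mdifferentiableWithinAt_extChartAt_symm (I := 𝓘(ℝ, EB)) (c.map_source hb)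
    rwa [ModelWithCorners.Boundaryless.range_eq_univ, mdifferentiableWithinAt_univ] at h
  have heq : (c.symm ∘ c) =ᶠ[𝓝 b] id := by
    filter_upwards [extChartAt_source_mem_nhds' (I := 𝓘(ℝ, EB)) hb] with y hy
    exact c.left_inv hy
  have hD : HasMFDerivAt 𝓘(ℝ, EB) 𝓘(ℝ, EB) (c.symm ∘ c) b
      ((mfderiv 𝓘(ℝ, EB) 𝓘(ℝ, EB) c.symm (c b)).comp (mfderiv 𝓘(ℝ, EB) 𝓘(ℝ, EB) c b)) :=
    hsd.hasMFDerivAt.comp b hcd.hasMFDerivAt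
  have hI : HasMFDerivAt 𝓘(ℝ, EB) 𝓘(ℝ, EB) (c.symm ∘ c) b
      (ContinuousLinearMap.id ℝ (TangentSpace 𝓘(ℝ, EB) b)) :=
    (hasMFDerivAt_id b).congr_of_eventuallyEq heq
  have key : ∀ v, mfderiv 𝓘(ℝ, EB) 𝓘(ℝ, EB) c.symm (c b) (mfderiv 𝓘(ℝ, EB) 𝓘(ℝ, EB) c b v) = v :=
    fun v ↦ by
      have h := DFunLike.congr_fun (hasMFDerivAt_unique hD hI) v
      exact h
  intro v w hvw
  rw [← key v, ← key w, hvw]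

end Chart

section Periods

variable {EX : Type u} [NormedAddCommGroup EX] [NormedSpace ℂ EX] [FiniteDimensional ℂ EX]
  [MeasurableSpace EX] [BorelSpace EX] {N : ℕ} [Fact (Module.finrank ℝ EX = N)]
  {E𝒳 : Type u} [NormedAddCommGroup E𝒳] [NormedSpace ℂ E𝒳] [FiniteDimensional ℂ E𝒳]
  {𝒳 : Type u} [TopologicalSpace 𝒳] [ChartedSpace E𝒳 𝒳] [IsManifold 𝓘(ℂ, E𝒳) ω 𝒳]
  [T2Space 𝒳] [SecondCountableTopology 𝒳]
  {EB : Type u} [NormedAddCommGroup EB] [NormedSpace ℂ EB] [FiniteDimensional ℂ EB]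
  {B : Type u} [TopologicalSpace B] [ChartedSpace EB B] [IsManifold 𝓘(ℂ, EB) ω B]
  {π : 𝒳 → B}

omit [FiniteDimensional ℂ EX] [MeasurableSpace EX] [BorelSpace EX] [T2Space 𝒳]
  [SecondCountableTopology 𝒳] in
/-- **`dπ` kills the tangent vectors of a fibre**: `dπ_{ι x}(dι_x w) = 0` for a fibre embedding `ι`
(`π ∘ ι` is constant; real differentials). [cite: VoisinHodgeI2002, §9.1.2] -/
theorem mfderiv_proj_mfderiv_fibreEmbedding_eq_zero (hπ : IsProperHolomorphicSubmersion E𝒳 EB π)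
    {b : B} {X : Type u} [TopologicalSpace X] [ChartedSpace EX X] [IsManifold 𝓘(ℂ, EX) ω X]
    {ι : X → 𝒳} (hι : IsFibreEmbedding EX E𝒳 π b ι) (x : X) (w : EX) :
    mfderiv 𝓘(ℝ, E𝒳) 𝓘(ℝ, EB) π (ι x) (mfderiv 𝓘(ℝ, EX) 𝓘(ℝ, E𝒳) ι x w) = 0 := by
  haveI : IsManifold 𝓘(ℝ, E𝒳) ∞ 𝒳 := isManifold_real_of_isManifold_complex
  haveI : IsManifold 𝓘(ℝ, EB) ∞ B := isManifold_real_of_isManifold_complex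
  haveI : IsManifold 𝓘(ℝ, EX) ∞ X := isManifold_real_of_isManifold_complex
  have hιd : MDifferentiableAt 𝓘(ℝ, EX) 𝓘(ℝ, E𝒳) ι x := hι.contMDiff_real.mdifferentiableAt (by simp)
  have hπd : MDifferentiableAt 𝓘(ℝ, E𝒳) 𝓘(ℝ, EB) π (ι x) :=
    (contMDiff_real_of_mdifferentiable (n := ∞)
      (hπ.contMDiff.mdifferentiable (by simp))).mdifferentiableAt (by simp)
  have hconst : π ∘ ι = fun _ ↦ b := funext fun y ↦ hι.apply_eq y
  have h1 : mfderiv 𝓘(ℝ, EX) 𝓘(ℝ, EB) (π ∘ ι) x =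
      (mfderiv 𝓘(ℝ, E𝒳) 𝓘(ℝ, EB) π (ι x)).comp (mfderiv 𝓘(ℝ, EX) 𝓘(ℝ, E𝒳) ι x) :=
    mfderiv_comp x hπd hιd
  have h2 : mfderiv 𝓘(ℝ, EX) 𝓘(ℝ, EB) (π ∘ ι) x = 0 := by
    rw [hconst]; exact mfderiv_const
  have := DFunLike.congr_fun (h1.symm.trans h2) w
  exact this

/-- **Periods of fibrewise-closed relative forms are holomorphic in the base; chart-ball form**
(Griffiths 1968 Thm. 1.1 / Voisin I Thm. 10.3 for `F^n𝓗^n`, proof of Thm. 10.9, in period form and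
WITHOUT any named fact). See the module docstring for the data. Conclusion: the chart-ball
trivialisation `Φ` of `exists_chartBall_trivialisation` (clauses re-exported: radius, (0) central
fibre, (1) fibres, (2) joint smoothness, (3) injective immersions, (4) diffeomorphisms
`e_p : X s₀ ≅ X (c⁻¹ p)` with `ι (c⁻¹ p) ∘ e_p = Φ p`), and in addition (5) every `(Φ p)^* Ξ` is a smooth
CLOSED form on `X s₀`, and (6) for every smooth closed `l`-form `γ` on `X s₀` the period
`p ↦ ∫_{X s₀} γ ∧ (Φ p)^* Ξ` is `AnalyticOnNhd ℂ` on the chart ball.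
[cite: Griffiths1968PeriodsII, Thm. 1.1] [cite: VoisinHodgeI2002, §10.2.1 Thm. 10.3 and §10.2.2]
[cite: Griffiths1969, §8] [cite: FritzscheGrauert2002, Ch. I §8 Thm. 8.5] -/
theorem IsProperHolomorphicSubmersion.exists_chartBall_trivialisation_periods_analytic
    (hπ : IsProperHolomorphicSubmersion E𝒳 EB π) {O : Set B} (hO : IsOpen O) {s₀ : B} (hs₀ : s₀ ∈ O)
    {X : B → Type u} [∀ b, TopologicalSpace (X b)] [∀ b, ChartedSpace EX (X b)]
    [∀ b, IsManifold 𝓘(ℂ, EX) ω (X b)] {ι : ∀ b, X b → 𝒳}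
    (hι : ∀ b ∈ O, IsFibreEmbedding EX E𝒳 π b (ι b))
    (hdim : Module.finrank ℂ EX + Module.finrank ℂ EB = Module.finrank ℂ E𝒳)
    [CompactSpace (X s₀)] [T2Space (X s₀)] [IsManifold 𝓘(ℝ, EX) ∞ (X s₀)]
    {o : (x : X s₀) → Orientation ℝ (TangentSpace 𝓘(ℝ, EX) x) (Fin N)} (ho : IsContinuousOrientation o)
    {k l : ℕ} (hkl : l + (k + 1) = N)
    {Ξ : MForm 𝓘(ℝ, E𝒳) 𝒳 ℂ (k + 1)} (hΞ : IsSmoothForm Ξ)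
    (hΞc : ∀ b ∈ O, IsClosedForm (Ξ.pullback 𝓘(ℝ, EX) (ι b)))
    (hdΞ : ∀ y, π y ∈ O → ∀ (v : E𝒳) (w : Fin (k + 1) → E𝒳),
      (∀ i, mfderiv 𝓘(ℝ, E𝒳) 𝓘(ℝ, EB) π y (w i) = 0) →
      (show E𝒳 [⋀^Fin (k + 1 + 1)]→L[ℝ] ℂ from mextDeriv Ξ y) (Fin.cons (I • v) w) =
        I * (show E𝒳 [⋀^Fin (k + 1 + 1)]→L[ℝ] ℂ from mextDeriv Ξ y) (Fin.cons v w)) :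
    ∃ (r : ℝ) (Φ : EB → X s₀ → 𝒳), 0 < r ∧
      ball (extChartAt 𝓘(ℂ, EB) s₀ s₀) r ⊆ (extChartAt 𝓘(ℂ, EB) s₀).target ∧
      (∀ p ∈ ball (extChartAt 𝓘(ℂ, EB) s₀ s₀) r, (extChartAt 𝓘(ℂ, EB) s₀).symm p ∈ O) ∧
      (∀ x, Φ (extChartAt 𝓘(ℂ, EB) s₀ s₀) x = ι s₀ x) ∧
      (∀ p ∈ ball (extChartAt 𝓘(ℂ, EB) s₀ s₀) r, ∀ x, π (Φ p x) = (extChartAt 𝓘(ℂ, EB) s₀).symm p) ∧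
      ContMDiffOn (𝓘(ℝ, EB).prod 𝓘(ℝ, EX)) 𝓘(ℝ, E𝒳) ∞ (uncurry Φ)
        (ball (extChartAt 𝓘(ℂ, EB) s₀ s₀) r ×ˢ univ) ∧
      (∀ p ∈ ball (extChartAt 𝓘(ℂ, EB) s₀ s₀) r,
        ContMDiff 𝓘(ℝ, EX) 𝓘(ℝ, E𝒳) ∞ (Φ p) ∧ Injective (Φ p) ∧
          (∀ x, Injective (mfderiv 𝓘(ℝ, EX) 𝓘(ℝ, E𝒳) (Φ p) x)) ∧
          range (Φ p) = π ⁻¹' {(extChartAt 𝓘(ℂ, EB) s₀).symm p}) ∧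
      (∀ p ∈ ball (extChartAt 𝓘(ℂ, EB) s₀ s₀) r,
        ∃ e : X s₀ ≃ₘ^∞⟮𝓘(ℝ, EX), 𝓘(ℝ, EX)⟯ X ((extChartAt 𝓘(ℂ, EB) s₀).symm p),
          ∀ x, ι ((extChartAt 𝓘(ℂ, EB) s₀).symm p) (e x) = Φ p x) ∧
      (∀ p ∈ ball (extChartAt 𝓘(ℂ, EB) s₀ s₀) r,
        IsSmoothForm (Ξ.pullback 𝓘(ℝ, EX) (Φ p)) ∧ IsClosedForm (Ξ.pullback 𝓘(ℝ, EX) (Φ p))) ∧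
      ∀ γ : MForm 𝓘(ℝ, EX) (X s₀) ℂ l, IsSmoothForm γ → IsClosedForm γ →
        AnalyticOnNhd ℂ (fun p ↦ cintegral o (((γ.wedge (Ξ.pullback 𝓘(ℝ, EX) (Φ p))).castDeg hkl)))
          (ball (extChartAt 𝓘(ℂ, EB) s₀ s₀) r) := by
  haveI : IsManifold 𝓘(ℝ, E𝒳) ∞ 𝒳 := isManifold_real_of_isManifold_complex
  haveI : IsManifold 𝓘(ℝ, EB) ∞ B := isManifold_real_of_isManifold_complex
  haveI : ∀ b, IsManifold 𝓘(ℝ, EX) ∞ (X b) := fun b ↦ isManifold_real_of_isManifold_complex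
  haveI : FiniteDimensional ℝ EB := FiniteDimensional.complexToReal EB
  obtain ⟨r, Φ, hr, hbt, hbO, hΦ0, hπΦ, hΦsm, himm, hdiff⟩ :=
    hπ.exists_chartBall_trivialisation hO hs₀ hι
  set c := extChartAt 𝓘(ℂ, EB) s₀ with hc
  have hcℝ : extChartAt 𝓘(ℝ, EB) s₀ = c := rfl
  -- the diffeomorphisms `e_p : X s₀ ≅ X (c⁻¹ p)` with `ι (c⁻¹ p) ∘ e_p = Φ p`
  choose e he using hdiff
  -- (5) `(Φ p)^* Ξ = e_p^* ((ι b)^* Ξ)` is smooth and closed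
  have hpull : ∀ p (hp : p ∈ ball (c s₀) r),
      Ξ.pullback 𝓘(ℝ, EX) (Φ p) =
        (Ξ.pullback 𝓘(ℝ, EX) (ι (c.symm p))).pullback 𝓘(ℝ, EX) (e p hp) := by
    intro p hp
    have hfun : Φ p = ι (c.symm p) ∘ (e p hp) := funext fun x ↦ (he p hp x).symm
    rw [hfun]
    exact MForm.pullback_comp ((hι _ (hbO p hp)).contMDiff_real.mdifferentiable (by simp))
      ((e p hp).contMDiff.mdifferentiable (by simp)) Ξ
  have h5 : ∀ p ∈ ball (c s₀) r,
      IsSmoothForm (Ξ.pullback 𝓘(ℝ, EX) (Φ p)) ∧ IsClosedForm (Ξ.pullback 𝓘(ℝ, EX) (Φ p)) := by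
    intro p hp
    have hb := hbO p hp
    have hsm : IsSmoothForm (Ξ.pullback 𝓘(ℝ, EX) (ι (c.symm p))) :=
      isSmoothForm_pullback (hι _ hb).contMDiff_real hΞ
    have hmem := pullback_mem_closedSmoothForms (I := 𝓘(ℝ, EX)) (I' := 𝓘(ℝ, EX)) (F := ℂ)
      (e p hp).contMDiff ⟨hsm, hΞc _ hb⟩
    rw [hpull p hp]
    exact ⟨hmem.1, hmem.2⟩
  refine ⟨r, Φ, hr, hbt, hbO, hΦ0, hπΦ, hΦsm, himm, fun p hp ↦ ⟨e p hp, he p hp⟩, h5,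
    fun γ hγ hγc ↦ ?_⟩
  -- (6) analyticity: complex differentiability at every point of the ball (B1), then Osgood
  have hU : IsOpen (ball (c s₀) r) := isOpen_ball
  suffices hdiffℂ : ∀ p ∈ ball (c s₀) r, DifferentiableAt ℂ
      (fun p ↦ cintegral o (((γ.wedge (Ξ.pullback 𝓘(ℝ, EX) (Φ p))).castDeg hkl))) p from
    fun p hp ↦ SCV.analyticAt_of_differentiableOn (fun q hq ↦ (hdiffℂ q hq).differentiableWithinAt)
      hU hp
  intro p hp
  have hb : c.symm p ∈ O := hbO p hp
  have hιb := hι _ hb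
  haveI : CompactSpace (X (c.symm p)) := hιb.compactSpace hπ.isProperMap
  -- the projection `proj = c ∘ π`, holomorphic near the fibre
  set proj : 𝒳 → EB := fun y ↦ c (π y) with hproj
  have hbs : c.symm p ∈ (chartAt EB s₀).source := by
    rw [← extChartAt_source (I := 𝓘(ℂ, EB)) s₀]; exact c.map_target (hbt hp)
  have hprojℂ : ∀ x, MDifferentiableAt 𝓘(ℂ, E𝒳) 𝓘(ℂ, EB) proj (Φ p x) := fun x ↦ by
    have h1 : MDifferentiableAt 𝓘(ℂ, EB) 𝓘(ℂ, EB) c (π (Φ p x)) := by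
      rw [hπΦ p hp x]; exact mdifferentiableAt_extChartAt hbs
    exact h1.comp (Φ p x) (hπ.contMDiff.mdifferentiableAt (by simp))
  have hπΨ : ∀ p' ∈ ball (c s₀) r, ∀ x, proj (Φ p' x) = p' := fun p' hp' x ↦ by
    simp only [hproj, hπΦ p' hp' x]
    exact c.right_inv (hbt hp')
  have hπd : ∀ x, MDifferentiableAt 𝓘(ℝ, E𝒳) 𝓘(ℝ, EB) proj (Φ p x) := fun x ↦
    MDifferentiableAt.real_of_complex (hprojℂ x)
  have hπℂ : ∀ x (v : E𝒳), mfderiv 𝓘(ℝ, E𝒳) 𝓘(ℝ, EB) proj (Φ p x) (I • v) =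
      I • (show EB from mfderiv 𝓘(ℝ, E𝒳) 𝓘(ℝ, EB) proj (Φ p x) v) := fun x v ↦
    mfderiv_real_apply_smul (hprojℂ x) I v
  -- the presentation of the fibre over `c⁻¹ p`: `Φ p = ι b ∘ e_p`
  have hΨ : ∀ p' ∈ ball (c s₀) r, ∀ x,
      ContMDiffAt (𝓘(ℝ, EB).prod 𝓘(ℝ, EX)) 𝓘(ℝ, E𝒳) ∞ (uncurry Φ) (p', x) := fun p' hp' x ↦
    (hΦsm (p', x) ⟨hp', mem_univ x⟩).contMDiffAt ((hU.prod isOpen_univ).mem_nhds ⟨hp', mem_univ x⟩)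
  have hιφ : ι (c.symm p) ∘ (e p hp) = Φ p := funext fun x ↦ he p hp x
  have hιℂ : ∀ y (v : EX), mfderiv 𝓘(ℝ, EX) 𝓘(ℝ, E𝒳) (ι (c.symm p)) y (I • v) =
      I • (show E𝒳 from mfderiv 𝓘(ℝ, EX) 𝓘(ℝ, E𝒳) (ι (c.symm p)) y v) := fun y v ↦
    mfderiv_real_apply_smul (hιb.contMDiff.mdifferentiableAt (by simp)) I v
  -- verticality: `ker d(proj) = ker dπ = range dι` along the fibre
  have hcinj : Injective (mfderiv 𝓘(ℝ, EB) 𝓘(ℝ, EB) c (c.symm p)) :=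
    injective_mfderiv_real_extChartAt s₀ (c.map_target (hbt hp))
  have hker : ∀ x (w : E𝒳), mfderiv 𝓘(ℝ, E𝒳) 𝓘(ℝ, EB) proj (Φ p x) w = 0 →
      mfderiv 𝓘(ℝ, E𝒳) 𝓘(ℝ, EB) π (Φ p x) w = 0 := by
    intro x w hw
    have hπdr : MDifferentiableAt 𝓘(ℝ, E𝒳) 𝓘(ℝ, EB) π (Φ p x) :=
      MDifferentiableAt.real_of_complex (hπ.contMDiff.mdifferentiableAt (by simp))
    have hcd : MDifferentiableAt 𝓘(ℝ, EB) 𝓘(ℝ, EB) c (π (Φ p x)) := by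
      rw [hπΦ p hp x]
      exact MDifferentiableAt.real_of_complex (mdifferentiableAt_extChartAt hbs)
    have hcomp : mfderiv 𝓘(ℝ, E𝒳) 𝓘(ℝ, EB) proj (Φ p x) =
        (mfderiv 𝓘(ℝ, EB) 𝓘(ℝ, EB) c (π (Φ p x))).comp (mfderiv 𝓘(ℝ, E𝒳) 𝓘(ℝ, EB) π (Φ p x)) :=
      mfderiv_comp (Φ p x) hcd hπdr
    rw [hcomp] at hw
    rw [hπΦ p hp x] at hw
    apply hcinj
    rw [map_zero]
    exact hw
  have hvert : ∀ x (w : E𝒳), mfderiv 𝓘(ℝ, E𝒳) 𝓘(ℝ, EB) proj (Φ p x) w = 0 →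
      ∃ w' : EX, mfderiv 𝓘(ℝ, EX) 𝓘(ℝ, E𝒳) (ι (c.symm p)) ((e p hp) x) w' = w := by
    intro x w hw
    have hw' := hker x w hw
    rw [← he p hp x] at hw'
    exact exists_mfderiv_eq_of_mfderiv_proj_eq_zero hπ hιb hdim ((e p hp) x) w hw'
  -- the vertical `(1,0)`-condition at the points of the fibre
  have hdΞ' : ∀ x (v : E𝒳) (w : Fin (k + 1) → EX),
      (show E𝒳 [⋀^Fin (k + 1 + 1)]→L[ℝ] ℂ from mextDeriv Ξ (Φ p x))
          (Fin.cons (I • v) fun i ↦ (show E𝒳 from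
            mfderiv 𝓘(ℝ, EX) 𝓘(ℝ, E𝒳) (ι (c.symm p)) ((e p hp) x) (w i))) =
        I * (show E𝒳 [⋀^Fin (k + 1 + 1)]→L[ℝ] ℂ from mextDeriv Ξ (Φ p x))
          (Fin.cons v fun i ↦ (show E𝒳 from
            mfderiv 𝓘(ℝ, EX) 𝓘(ℝ, E𝒳) (ι (c.symm p)) ((e p hp) x) (w i))) := by
    intro x v w
    refine hdΞ (Φ p x) (by rw [hπΦ p hp x]; exact hb) v _ fun i ↦ ?_
    have h := mfderiv_proj_mfderiv_fibreEmbedding_eq_zero hπ hιb ((e p hp) x) (w i)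
    rw [he p hp x] at h
    exact h
  -- the test form on the fibre model `X b`: `β = (e_p⁻¹)^* γ`, so that `e_p^* β = γ`
  set β : MForm 𝓘(ℝ, EX) (X (c.symm p)) ℂ l := γ.pullback 𝓘(ℝ, EX) (e p hp).symm with hβdef
  have hβmem := pullback_mem_closedSmoothForms (I := 𝓘(ℝ, EX)) (I' := 𝓘(ℝ, EX)) (F := ℂ)
    (e p hp).symm.contMDiff ⟨hγ, hγc⟩
  have hβγ : β.pullback 𝓘(ℝ, EX) (e p hp) = γ := by
    rw [hβdef, ← MForm.pullback_comp ((e p hp).symm.contMDiff.mdifferentiable (by simp))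
      ((e p hp).contMDiff.mdifferentiable (by simp))]
    have : ((e p hp).symm : X (c.symm p) → X s₀) ∘ (e p hp) = id :=
      funext fun x ↦ (e p hp).symm_apply_apply x
    rw [this, MForm.pullback_id]
  have hB1 := differentiableAt_complex_cintegral_wedge_pullback_family_of_vertical (EM := EX)
    (M := X s₀) (ET := E𝒳) (T := 𝒳) (EX := EX) (X := X (c.symm p)) (P := EB) ho hU hp hΨ hπΨ
    hπd hπℂ hιφ hιb.contMDiff_real (e p hp).contMDiff hιℂ hvert hkl hΞ (hΞc _ hb) hdΞ' hβmem.1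
    hβmem.2
  rw [hβγ] at hB1
  exact hB1

end Periods

end Literature.AlgebraicGeometry.HodgeTheory

end
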